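import Mathlib
import Summits.ValiantsHypothesis.ValiantsHypothesis.Theorems.AlgebraicKWGamesBoundedAlternationLowerBoundRun
import Summits.ValiantsHypothesis.ValiantsHypothesis.Theorems.AlgebraicKWGamesBoundedAlternationLowerBoundRank

/-!
# Bounded-alternation algebraic KW protocols: the rank potential of one adversary round

Support lemmas for item `stmt-ValiantsHypothesis-10299` (`…Theses.AlgebraicKWGames.BoundedAlternationLowerBound`).
For an `AltProtocol` `P`, an identified set `E` and a block index `v`, the *prefix* `P.Pref E v` is the
set of generic messages (rounds `< T`) of the blocks `< v`; Alice's inputs are the `x`-variables `Xall`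
and Bob's `E`-inputs are `BE E = {y_c : c ∉ E} ∪ {x_c : c ∈ E}`.  The two rank measures of the
adversary are `rk (Xall ∪ Pref E v)` and `rk (BE E ∪ Pref E v)` in the algebraic-independence matroid.

Main result of this file, `AltProtocol.round`: one adversary round from `E` (two cells to spare) yields
a new cell `e = genOut E ∉ E` and a block index `v₀ ≤ blk` of the first killed round such that, with
`E' = insert e E`, both measures weakly decrease for every `v ≤ v₀` and the measure of the speaker of
block `v₀` strictly decreases at `v₀` (by `eRk_image_lt` applied to `subst E'`).

Honest framing: bookkeeping for a toy-model lower bound; nothing here bears on VP versus VNP.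
-/

open MvPolynomial

-- the summit and the problem share the name `ValiantsHypothesis` (D-0017 single-conjunct layout)
set_option linter.dupNamespace false

namespace Summit.ValiantsHypothesis.ValiantsHypothesis.Theorems.AlgebraicKWGames.OneAlt

open scoped Classical

noncomputable section

variable {n : ℕ}

/-! ## Bob's inputs and closures of generated subalgebras -/

/-- Bob's inputs on the subspace `E`: `y_c` for `c ∉ E` and `x_c` for `c ∈ E`. -/
def BE (E : Finset (Cell n)) : Set (R n) := Set.range fun c : Cell n => subst E (X (Sum.inr c))

/-- Identifying one more cell maps Bob's `E`-inputs onto Bob's `insert e E`-inputs. -/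
theorem image_subst_BE {E F : Finset (Cell n)} (hEF : E ⊆ F) : subst F '' BE E = (BE F : Set (R n)) := by
  ext q
  simp only [BE, Set.mem_image, Set.mem_range]
  constructor
  · rintro ⟨_, ⟨c, rfl⟩, rfl⟩
    exact ⟨c, by rw [subst_subst_of_subset hEF]⟩
  · rintro ⟨c, rfl⟩
    exact ⟨_, ⟨c, rfl⟩, by rw [subst_subst_of_subset hEF]⟩

/-- `subst F` fixes Alice's variables (as a set). -/
theorem image_subst_Xall (F : Finset (Cell n)) : subst F '' (Xall : Set (R n)) = Xall := by
  ext q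
  simp only [Xall, Set.mem_image, Set.mem_range]
  constructor
  · rintro ⟨_, ⟨c, rfl⟩, rfl⟩
    exact ⟨c, by rw [subst_X_inl]⟩
  · rintro ⟨c, rfl⟩
    exact ⟨_, ⟨c, rfl⟩, by rw [subst_X_inl]⟩

/-- Bob's `E`-inputs as an image of variables. -/
theorem BE_eq_image (E : Finset (Cell n)) : (BE E : Set (R n)) =
    (fun v => (X v : R n)) '' (Sum.inl '' (E : Set (Cell n)) ∪ Sum.inr '' (↑E)ᶜ) := by
  ext q
  simp only [BE, Set.mem_range, Set.mem_image, Set.mem_union, subst_X_inr]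
  constructor
  · rintro ⟨c, rfl⟩
    by_cases hc : c ∈ E
    · exact ⟨Sum.inl c, Or.inl ⟨c, hc, rfl⟩, by rw [if_pos hc]⟩
    · exact ⟨Sum.inr c, Or.inr ⟨c, hc, rfl⟩, by rw [if_neg hc]⟩
  · rintro ⟨v, hv, rfl⟩
    rcases hv with ⟨c, hc, rfl⟩ | ⟨c, hc, rfl⟩
    · exact ⟨c, by rw [if_pos (Finset.mem_coe.mp hc)]⟩
    · exact ⟨c, by rw [if_neg (fun h => hc (Finset.mem_coe.mpr h))]⟩

/-- Bob's inputs are independent. -/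
theorem indep_BE (E : Finset (Cell n)) : (Mat n).Indep (BE E : Set (R n)) := by
  rw [BE_eq_image]; exact indep_image_X _

/-- Alice's inputs are independent. -/
theorem indep_Xall : (Mat n).Indep (Xall : Set (R n)) := by
  have : (Xall : Set (R n)) = (fun v => (X v : R n)) '' Set.range Sum.inl := by
    ext q; simp [Xall, Set.mem_image, Set.mem_range]
  rw [this]; exact indep_image_X _

/-- Bob's `E`-inputs are indexed injectively by the cells. -/
theorem BE_injective (E : Finset (Cell n)) :
    Function.Injective fun c : Cell n => subst E (X (Sum.inr c)) := by
  intro c c' h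
  simp only [subst_X_inr] at h
  split_ifs at h <;>
    first
    | exact (Sum.inl_injective (X_injective (σ := Var n) (R := ℂ) h))
    | exact (Sum.inr_injective (X_injective (σ := Var n) (R := ℂ) h))
    | exact absurd (X_injective (σ := Var n) (R := ℂ) h) (by simp)

/-- Bob has `n²` inputs. -/
theorem encard_BE (E : Finset (Cell n)) : (BE E : Set (R n)).encard = Fintype.card (Cell n) := by
  rw [BE, ← Set.image_univ, (BE_injective E).injOn.encard_image, Set.encard_univ,
    ENat.card_eq_coe_fintype_card]

/-- Alice has `n²` inputs. -/
theorem encard_Xall : (Xall : Set (R n)).encard = Fintype.card (Cell n) := by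
  have hinj : Function.Injective fun c : Cell n => (X (Sum.inl c) : R n) := fun c c' h =>
    Sum.inl_injective (X_injective (σ := Var n) (R := ℂ) h)
  rw [Xall, ← Set.image_univ, hinj.injOn.encard_image, Set.encard_univ, ENat.card_eq_coe_fintype_card]

/-- Bob's inputs form a finite set. -/
theorem BE_finite (E : Finset (Cell n)) : (BE E : Set (R n)).Finite := Set.finite_range _

/-- Alice's inputs form a finite set. -/
theorem Xall_finite : (Xall : Set (R n)).Finite := Set.finite_range _

/-- A subalgebra generated inside a matroid closure stays inside it. -/
theorem adjoin_subset_closure {Z W : Set (R n)} (h : Z ⊆ (Mat n).closure W) :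
    ((Algebra.adjoin ℂ Z : Subalgebra ℂ (R n)) : Set (R n)) ⊆ (Mat n).closure W := by
  rw [AlgebraicIndependent.matroid_closure_eq] at h ⊢
  exact Algebra.adjoin_le (S := (Subalgebra.algebraicClosure (Algebra.adjoin ℂ W) (R n)).restrictScalars ℂ) h

/-! ## Prefixes and the two measures -/

/-- The speaker's `E`-inputs in a block with index `v`: Alice's variables if `v` is even, Bob's
`E`-inputs otherwise. -/
def base (E : Finset (Cell n)) (v : ℕ) : Set (R n) := if Even v then Xall else BE E

/-- The speaker's inputs form a finite set. -/
theorem base_finite (E : Finset (Cell n)) (v : ℕ) : (base E v).Finite := by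
  unfold base; split_ifs
  · exact Xall_finite
  · exact BE_finite E

/-- The speaker's inputs are independent. -/
theorem indep_base (E : Finset (Cell n)) (v : ℕ) : (Mat n).Indep (base E v) := by
  unfold base; split_ifs
  · exact indep_Xall
  · exact indep_BE E

/-- The speaker has `n²` inputs. -/
theorem encard_base (E : Finset (Cell n)) (v : ℕ) : (base E v).encard = Fintype.card (Cell n) := by
  unfold base; split_ifs
  · exact encard_Xall
  · exact encard_BE E

/-- Identifying more cells maps the speaker's `E`-inputs onto the `F`-inputs. -/
theorem image_subst_base {E F : Finset (Cell n)} (hEF : E ⊆ F) (v : ℕ) :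
    subst F '' base E v = base F v := by
  unfold base; split_ifs
  · exact image_subst_Xall F
  · exact image_subst_BE hEF

variable {T : ℕ} (P : AltProtocol n T)

namespace AltProtocol

/-- After identification on `E`, the speaker's variables of round `t` are the `E`-inputs of its block. -/
theorem range_subst_vars (E : Finset (Cell n)) (t : ℕ) :
    Set.range (fun c => subst E (P.vars t c)) = base E (P.blk t) := by
  unfold base vars
  by_cases h : Even (P.blk t)
  · simp only [if_pos h, subst_X_inl]; rfl
  · simp only [if_neg h]; rfl

/-- The generic messages (rounds `< T`) of the blocks `< v` on the subspace `E`. -/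
def Pref (E : Finset (Cell n)) (v : ℕ) : Set (R n) := (fun j => P.gen E j) '' {j | j < T ∧ P.blk j < v}

/-- Prefixes are finite. -/
theorem Pref_finite (E : Finset (Cell n)) (v : ℕ) : (P.Pref E v).Finite :=
  ((Set.finite_Iio T).subset (fun _ hj => hj.1)).image _

/-- A prefix has at most `T` messages. -/
theorem encard_Pref_le (E : Finset (Cell n)) (v : ℕ) : (P.Pref E v).encard ≤ T := by
  refine (Set.encard_image_le _ _).trans ?_
  have h : ({j | j < T ∧ P.blk j < v} : Set ℕ) ⊆ (↑(Finset.range T) : Set ℕ) := by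
    intro j hj; simpa using hj.1
  refine (Set.encard_le_encard h).trans ?_
  rw [Set.encard_coe_eq_coe_finsetCard, Finset.card_range]

/-- Each generic message is a polynomial in the speaker's `E`-inputs and the earlier messages. -/
theorem gen_mem_adjoin_round (E : Finset (Cell n)) (t : ℕ) :
    P.gen E t ∈ Algebra.adjoin ℂ (base E (P.blk t) ∪ (fun j => P.gen E j) '' Set.Iio t) := by
  have h := P.subst_gen_eq_aeval (subset_rfl (a := E)) t
  rw [subst_gen] at h
  rw [h]
  refine (Algebra.adjoin_le ?_) (aeval_mem_adjoin_range _ _)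
  rintro _ ⟨i, rfl⟩
  rcases i with c | j
  · refine Algebra.subset_adjoin (Or.inl ?_)
    rw [← range_subst_vars]; exact ⟨c, rfl⟩
  · refine Algebra.subset_adjoin (Or.inr ⟨j, j.2, ?_⟩)
    simp only [Sum.elim_inr, subst_gen]

/-- Within a block, messages are absorbed: every generic message of a round `t < T` lies in the closure of
the speaker's inputs and the prefix of the earlier blocks. -/
theorem gen_mem_closure (E : Finset (Cell n)) :
    ∀ t < T, P.gen E t ∈ (Mat n).closure (base E (P.blk t) ∪ P.Pref E (P.blk t)) := by
  intro t
  induction t using Nat.strong_induction_on with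
  | _ t ih =>
    intro htT
    apply adjoin_subset_closure ?_ (P.gen_mem_adjoin_round E t)
    rintro q (hq | ⟨j, hj, rfl⟩)
    · exact (Mat n).subset_closure _ (by simp) (Or.inl hq)
    · have hjt : j < t := hj
      rcases (P.mono hjt.le).lt_or_eq with hlt | heq
      · exact (Mat n).subset_closure _ (by simp) (Or.inr ⟨j, ⟨lt_trans hjt htT, hlt⟩, rfl⟩)
      · have := ih j hjt (lt_trans hjt htT)
        rwa [heq] at this

/-- All earlier messages of a round `t₀ < T` lie in the closure of the speaker's inputs of block
`blk t₀` and the prefix of the earlier blocks. -/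
theorem image_Iio_subset_closure (E : Finset (Cell n)) {t₀ : ℕ} (ht₀ : t₀ < T) :
    base E (P.blk t₀) ∪ (fun j => P.gen E j) '' Set.Iio t₀ ⊆
      (Mat n).closure (base E (P.blk t₀) ∪ P.Pref E (P.blk t₀)) := by
  rintro q (hq | ⟨j, hj, rfl⟩)
  · exact (Mat n).subset_closure _ (by simp) (Or.inl hq)
  · have hjt : j < t₀ := hj
    rcases (P.mono hjt.le).lt_or_eq with hlt | heq
    · exact (Mat n).subset_closure _ (by simp) (Or.inr ⟨j, ⟨lt_trans hjt ht₀, hlt⟩, rfl⟩)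
    · have := P.gen_mem_closure E j (lt_trans hjt ht₀)
      rwa [heq] at this

/-- Rounds of earlier blocks come earlier. -/
theorem lt_of_blk_lt {j t : ℕ} (h : P.blk j < P.blk t) : j < t := by
  by_contra hle
  exact absurd (P.mono (not_lt.mp hle)) (not_le.mpr h)

/-! ## One adversary round -/

/-- **One adversary round.**  With two cells to spare, the generic output `e` of `E` is a new cell, and
for the block index `v₀` of the first round killed by identifying `e` (so `v₀ ≤ blk` of some round,
in particular `v₀ ≤ Δ` under an alternation bound): for every block index `v ≤ v₀` both measures do
not increase from `E` to `insert e E`, and the measure of the speaker of block `v₀` strictly drops. -/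
theorem round (E : Finset (Cell n)) {e₀ : Cell n} (he₀ : e₀ ∉ E) (hroom : ∀ e, ∃ e₁, e₁ ∉ insert e E) :
    P.genOut E ∉ E ∧ ∃ t₀ < T,
      (∀ v ≤ P.blk t₀,
        (Mat n).eRk (Xall ∪ P.Pref (insert (P.genOut E) E) v) ≤ (Mat n).eRk (Xall ∪ P.Pref E v) ∧
        (Mat n).eRk (BE (insert (P.genOut E) E) ∪ P.Pref (insert (P.genOut E) E) v) ≤
          (Mat n).eRk (BE E ∪ P.Pref E v)) ∧
      (Mat n).eRk (base (insert (P.genOut E) E) (P.blk t₀) ∪ P.Pref (insert (P.genOut E) E) (P.blk t₀))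
        < (Mat n).eRk (base E (P.blk t₀) ∪ P.Pref E (P.blk t₀)) := by
  obtain ⟨hnot, hkill⟩ := P.zariski_step E he₀ hroom
  refine ⟨hnot, ?_⟩
  set e := P.genOut E with he
  set F := insert e E with hF
  have hEF : E ⊆ F := Finset.subset_insert e E
  -- the first killed round
  have hex : ∃ t, t < T ∧ P.gen E t ≠ 0 ∧ subst F (P.gen E t) = 0 := by
    obtain ⟨t, ht, h1, h2⟩ := hkill; exact ⟨t, ht, h1, h2⟩
  let t₀ := Nat.find hex
  obtain ⟨ht₀T, hne, hkilled⟩ : t₀ < T ∧ P.gen E t₀ ≠ 0 ∧ subst F (P.gen E t₀) = 0 := Nat.find_spec hex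
  have hmin : ∀ j < t₀, ¬ (P.gen E j ≠ 0 ∧ subst F (P.gen E j) = 0) := by
    intro j hj hk
    exact Nat.find_min hex hj ⟨lt_trans hj ht₀T, hk⟩
  -- specialisation: the runs agree up to `t₀`
  have hspec : ∀ j ≤ t₀, P.gen F j = subst F (P.gen E j) := fun j hj =>
    P.gen_eq_subst_gen_of_not_killed hEF j (fun j' hj' => hmin j' (lt_of_lt_of_le hj' hj))
  have hPref : ∀ v ≤ P.blk t₀, P.Pref F v = subst F '' P.Pref E v := by
    intro v hv
    ext q
    simp only [Pref, Set.mem_image, Set.mem_setOf_eq]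
    constructor
    · rintro ⟨j, ⟨hjT, hjv⟩, rfl⟩
      have hjt : j < t₀ := P.lt_of_blk_lt (lt_of_lt_of_le hjv hv)
      exact ⟨P.gen E j, ⟨j, ⟨hjT, hjv⟩, rfl⟩, (hspec j hjt.le).symm⟩
    · rintro ⟨_, ⟨j, ⟨hjT, hjv⟩, rfl⟩, rfl⟩
      have hjt : j < t₀ := P.lt_of_blk_lt (lt_of_lt_of_le hjv hv)
      exact ⟨j, ⟨hjT, hjv⟩, hspec j hjt.le⟩
  refine ⟨t₀, ht₀T, ?_, ?_⟩
  · intro v hv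
    constructor
    · have h : (Xall ∪ P.Pref F v : Set (R n)) = subst F '' (Xall ∪ P.Pref E v) := by
        rw [Set.image_union, image_subst_Xall, hPref v hv]
      rw [h]
      exact eRk_image_le (subst F) _
    · have h : (BE F ∪ P.Pref F v : Set (R n)) = subst F '' (BE E ∪ P.Pref E v) := by
        rw [Set.image_union, image_subst_BE hEF, hPref v hv]
      rw [h]
      exact eRk_image_le (subst F) _
  · -- the strict drop at `v₀ = blk t₀`
    set S : Set (R n) := (fun j => P.gen E j) '' Set.Iio t₀ with hS
    have hSfin : S.Finite := (Set.finite_Iio t₀).image _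
    have hQ : P.gen E t₀ ∈ Algebra.adjoin ℂ (base E (P.blk t₀) ∪ S) := P.gen_mem_adjoin_round E t₀
    have hlt := eRk_image_lt (subst F) ((base_finite E _).union hSfin) hQ hne hkilled
    have hS' : subst F '' S = (fun j => P.gen F j) '' Set.Iio t₀ := by
      ext q
      simp only [hS, Set.mem_image, Set.mem_Iio]
      constructor
      · rintro ⟨_, ⟨j, hj, rfl⟩, rfl⟩; exact ⟨j, hj, hspec j hj.le⟩
      · rintro ⟨j, hj, rfl⟩; exact ⟨P.gen E j, ⟨j, hj, rfl⟩, (hspec j hj.le).symm⟩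
    rw [Set.image_union, image_subst_base hEF, hS'] at hlt
    -- compare with the prefixes
    have hup : (Mat n).eRk (base E (P.blk t₀) ∪ S) ≤
        (Mat n).eRk (base E (P.blk t₀) ∪ P.Pref E (P.blk t₀)) := by
      have h := (Mat n).eRk_mono (P.image_Iio_subset_closure E ht₀T)
      rwa [Matroid.eRk_closure_eq] at h
    have hdown : (Mat n).eRk (base F (P.blk t₀) ∪ P.Pref F (P.blk t₀)) ≤
        (Mat n).eRk (base F (P.blk t₀) ∪ (fun j => P.gen F j) '' Set.Iio t₀) := by
      apply (Mat n).eRk_mono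
      rintro q (hq | ⟨j, ⟨hjT, hjv⟩, rfl⟩)
      · exact Or.inl hq
      · exact Or.inr ⟨j, P.lt_of_blk_lt hjv, rfl⟩
    exact lt_of_le_of_lt hdown (lt_of_lt_of_le hlt hup)

end AltProtocol

end

end Summit.ValiantsHypothesis.ValiantsHypothesis.Theorems.AlgebraicKWGames.OneAlt
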